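/-
Copyright (c) 2026. All rights reserved.
Released under Apache 2.0 license as described in the file LICENSE.
Authors: HodgeCM publication cell (pub-hodgecm), GR lane, seat GR-2 (`pub-hodgecm-own-hyp34`).
-/
import Literature.NumberTheory.GelbartRogawski1991.Prop311AsPrinted
import Literature.NumberTheory.Automorphic.UnitaryGroupSymplecticCarriers
import HarnessLib

/-!
# [GelbartRogawski1991, §3.1]: the PRINTED adelic space `W_𝐀 = 𝐀 ⊗_F V` in an `E`-frame — the coordinates
# `W_𝐀 ≃ 𝐀ᴺ × 𝐀ᴺ` onto the carrier of the tree's `U(J)(𝔸_F) → Sp_{2N}(𝔸_F)`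

Topic `NumberTheory/GelbartRogawski1991`; namespace `Literature.NumberTheory.GelbartRogawski1991.Prop311` (the
namespace of the auxiliary objects of the statement-exact typing `Prop311AsPrinted`).  Definitions and proved
lemmas only; nothing of [GelbartRogawski1991] is asserted; `Prop311AsPrinted` is untouched.

[GelbartRogawski1991, §3.1 p. 454 L37–42]: "*Let `(V, Φ)` be a skew Hermitian space, where `V` is an
`n`-dimensional vector space over `E`. … Let `(W, φ)` be the associated symplectic space over `F`. That is, `W`
coincides with `V`, but viewed as an `F`-vector space, and `φ = Tr_{E/F}(Φ)`.*"  The statement-exact typing renders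
`W_𝐀` FRAME-FREE as `Prop311.AdelicSpace F V = 𝐀 ⊗_F V` (`𝐀 = AdeleRing (𝓞 F) F`), the scalars of `E` acting through
`Prop311.scalarE e = 1 ⊗ (e • ·)`, whereas the tree's unitary ∕ symplectic carriers
(`Automorphic/UnitaryGroupSymplecticEmbedding`, `…Carriers`: `UnitaryGroup.adelic F E σ N J ≤ GL_N(𝔸_E)`,
`adelicToSymplectic : U(J)(𝔸_F) →* Sp(𝔸ᴺ × 𝔸ᴺ, alt (polar β_T))`) live on the `𝔸`-RATIONAL complete polarisation
`Res_{𝔸_E/𝔸} 𝔸_Eᴺ = 𝔸ᴺ · 1 ⊕ 𝔸ᴺ · δ` of the quadratic coordinates `𝔸_E = 𝔸 ⊕ 𝔸 δ`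
(`QuadraticRestrictionOfScalars.isQuadraticCoordinates_adele`, `Ψ_𝔸 = quadraticAdeleEquiv`, `σ δ = -δ`, `δ² = d`).
This file is the FRAME between the two: for an `E`-basis `b` of `V` (`N := n`),

* §1 `ratReIm`, **`ratFrame b : V ≃ₗ[F] Fᴺ × Fᴺ`**, `v = Σᵢ (aᵢ + bᵢ δ) bᵢ ↦ (a, b)` (the rational quadratic
  coordinates `quadraticRatCoords` of `E = F ⊕ F δ`, made `F`-LINEAR);
* §2 **`adelicFrame b : W_𝐀 = 𝐀 ⊗_F V ≃ₗ[𝐀] 𝐀ᴺ × 𝐀ᴺ`** (`= (ratFrame b) ⊗ 𝐀` followed by Mathlib's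
  `TensorProduct.prodRight` ∕ `piScalarRight`), with the formula on pure tensors
  **`adelicFrame b (t ⊗ v) = reIm Ψ_𝔸 (frameCoordE b t v)`**, `frameCoordE b t v = ((t ⊗ 1) · ([v]_b ⊗ 1))ᵢ ∈ 𝔸_Eᴺ`
  (`adelicFrame_tmul`; uses `adele_re/im_algebraMap`: `re_𝔸 (e ⊗ 1) = re_F e ⊗ 1`);
* §3 TRANSPORT OF THE `E`-STRUCTURE: **`adelicFrame b ∘ scalarE e = resEnd (e · 1_N) ∘ adelicFrame b`**
  (`adelicFrame_scalarE`) and, for an `E`-linear `g₀ : V → V`,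
  **`adelicFrame b ∘ (1 ⊗ g₀) = resEnd ([g₀]_b ⊗ 1) ∘ adelicFrame b`** (`adelicFrame_baseChange`) — print's
  "`g = 1 ⊗ g₀`" (`IsRationalPoint`) is the tree's "entries in `E ⊗ 1`";
* §4 the CENTRALISER LEMMA, generic over quadratic coordinates `S = R ⊕ R δ`
  (`IsQuadraticCoordinates.resEnd_injective`, **`existsUnique_resEnd_eq_of_comp_eq`**,
  **`existsUnique_resAut_eq_of_forall_apply`**): an `R`-linear endomorphism (automorphism) of `Rᴺ × Rᴺ` commuting
  with multiplication by `δ` is `resEnd G` (`resAut G`) for a unique `G ∈ M_N(S)` (`GL_N(S)`) — "`𝐀 ⊗_F E`-linear =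
  `𝔸_E`-linear";
* §5 hence **`adelicGLE F E V = GL_{𝐀 ⊗ E}(W_𝐀)`**, the `𝐀`-linear automorphisms of `W_𝐀` commuting with `E` (the
  first clause of `Prop311.adelicUnitary`; `adelicUnitary_le_adelicGLE`), and the group isomorphism
  **`frameGL b : adelicGLE F E V ≃* GL_N(𝔸_E)`** characterised by
  **`adelicFrame b (g w) = resAut (frameGL b g) (adelicFrame b w)`** (`adelicFrame_apply_eq_resAut_frameGL`);
* §6 CONTINUITY: `adelicFrame b` is a homeomorphism for the adelic (module) topology of `W_𝐀` (rendering R8 of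
  `Prop311AsPrinted`) and the product topology of `𝐀ᴺ × 𝐀ᴺ` (`continuous_adelicFrame`, `continuous_adelicFrame_symm`,
  `adelicFrameHomeomorph`).

This is the common input of the two junctions between the printed objects of Prop. 3.1.1 and the tree's carriers:
`G(𝐀) = Prop311.adelicUnitary F E V Φ` versus `UnitaryGroup.adelic F E σ N J` (through `frameGL`, once `Φ_𝐀` is read in
the frame), and `Sp_𝐀(W) = Prop311.adelicSp F E V Φ` versus `symplecticGroup (polar β_T)` (through `adelicFrame`, in a
`Φ`-orthogonal frame); unlike the generic Darboux coordinates of `Prop311AdelicCoordinates.exists_adelicDarboux` the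
frame here is adapted to the `E`-structure.

## References
* [GelbartRogawski1991] S. Gelbart, J. Rogawski, Invent. Math. 105 (1991) 445–472, §3.1 p. 454 L37–42, Prop. 3.1.1
  p. 455 L1–2.
* [MoeglinVignerasWaldspurger1987] C. Mœglin, M.-F. Vignéras, J.-L. Waldspurger, LNM 1291 (1987), Chap. 1 I.17–I.19
  (restriction of scalars `W = Res_{E/F} V`, `U(V) ⊂ Sp(W)`).
* [Lang2002] S. Lang, *Algebra*, GTM 211 (2002), Ch. VI §5 (the matrix of multiplication by an element), Ch. XIII §1
  (matrices and linear maps of free modules) — for the generic §4.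
-/

set_option autoImplicit false

noncomputable section

open NumberField
open scoped TensorProduct Matrix
open Literature.NumberTheory.Automorphic
open Literature.NumberTheory.Automorphic.UnitaryGroup

/-! ## §4 (generic). The centraliser of `δ` in `End_R(Rᴺ × Rᴺ)` is `M_N(S)` -/

namespace Literature.NumberTheory.Automorphic.UnitaryGroup.IsQuadraticCoordinates

open QuadraticCoordinates

variable {R S : Type*} [CommRing R] [CommRing S]
variable {φ : R →+* S} {Ψ : (R × R) ≃+ S} {δ : S} {d : R} (h : IsQuadraticCoordinates φ Ψ δ d)
variable (n : Type*) [Fintype n] [DecidableEq n]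
include h

omit [Fintype n] [DecidableEq n] in
/-- `reIm (φ a • x) = a • reIm x`: the coordinates of `Res_{S/R} Sᴺ` in the basis `(1, δ)` are `R`-linear.
[cite: Lang2002, Ch. VI §5] -/
theorem reIm_map_smul (a : R) (x : n → S) : reIm Ψ n (φ a • x) = a • reIm Ψ n x :=
  Prod.ext (funext fun i => by simp only [reIm_apply_fst, Prod.smul_fst, Pi.smul_apply, smul_eq_mul, h.re_map_mul])
    (funext fun i => by simp only [reIm_apply_snd, Prod.smul_snd, Pi.smul_apply, smul_eq_mul, h.im_map_mul])

omit [Fintype n] [DecidableEq n] in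
/-- `reIm⁻¹ (a • p) = φ a • reIm⁻¹ p`. [cite: Lang2002, Ch. VI §5] -/
theorem reIm_symm_smul (a : R) (p : (n → R) × (n → R)) : (reIm Ψ n).symm (a • p) = φ a • (reIm Ψ n).symm p := by
  apply (reIm Ψ n).injective
  rw [AddEquiv.apply_symm_apply, h.reIm_map_smul, AddEquiv.apply_symm_apply]

/-- `reIm (s • x) = resEnd (s · 1) (reIm x)`: multiplication by a scalar `s ∈ S` in the coordinates is the regular
representation (the matrix of multiplication by `s`). [cite: Lang2002, Ch. VI §5] -/
theorem reIm_delta_smul (s : S) (x : n → S) :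
    reIm Ψ n (s • x) = h.resEnd n (Matrix.scalar n s) (reIm Ψ n x) := by
  rw [h.resEnd_reIm]
  congr 1
  funext i
  rw [Matrix.scalar_apply, Matrix.mulVec_diagonal, Pi.smul_apply, smul_eq_mul]

/-- `resEnd : M_N(S) → End_R(Rᴺ × Rᴺ)` is injective (a matrix is determined by its linear map).
[cite: Lang2002, Ch. XIII §1] -/
theorem resEnd_injective : Function.Injective (h.resEnd n) := fun g g' hgg' => by
  refine Matrix.toLin'.injective (LinearMap.ext fun x => ?_)
  rw [Matrix.toLin'_apply, Matrix.toLin'_apply]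
  apply (reIm Ψ n).injective
  rw [← h.resEnd_reIm, ← h.resEnd_reIm, hgg']

/-- **centraliser lemma (endomorphisms)**: an `R`-linear endomorphism `T` of `Rᴺ × Rᴺ = Res_{S/R} Sᴺ` commuting with
multiplication by `δ` is `S = R[δ]`-linear, i.e. `T = resEnd G` for a unique `G ∈ M_N(S)` (the matrix of an `S`-linear
endomorphism of the free module `Sᴺ`). [cite: Lang2002, Ch. XIII §1] -/
theorem existsUnique_resEnd_eq_of_comp_eq (T : Module.End R ((n → R) × (n → R)))
    (hT : T ∘ₗ h.resEnd n (Matrix.scalar n δ) = h.resEnd n (Matrix.scalar n δ) ∘ₗ T) :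
    ∃! G : Matrix n n S, h.resEnd n G = T := by
  -- the map `f = reIm⁻¹ ∘ T ∘ reIm` of `Sᴺ`
  let f : (n → S) → (n → S) := fun x => (reIm Ψ n).symm (T (reIm Ψ n x))
  have hf_reIm : ∀ x, reIm Ψ n (f x) = T (reIm Ψ n x) := fun x => (reIm Ψ n).apply_symm_apply _
  have hf_add : ∀ x y, f (x + y) = f x + f y := fun x y => by
    simp only [f, map_add]
  have hf_map : ∀ (a : R) (x : n → S), f (φ a • x) = φ a • f x := fun a x => by
    simp only [f, h.reIm_map_smul, map_smul, h.reIm_symm_smul]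
  have hf_delta : ∀ x : n → S, f (δ • x) = δ • f x := fun x => by
    apply (reIm Ψ n).injective
    rw [hf_reIm, h.reIm_delta_smul, h.reIm_delta_smul, hf_reIm]
    exact LinearMap.congr_fun hT (reIm Ψ n x)
  have hf_smul : ∀ (s : S) (x : n → S), f (s • x) = s • f x := fun s x => by
    conv_lhs => rw [← h.re_add_im s]
    rw [add_smul, hf_add, mul_smul, hf_map, hf_map, hf_delta, ← mul_smul, ← add_smul, h.re_add_im]
  let fₗ : (n → S) →ₗ[S] (n → S) :=
    { toFun := f, map_add' := hf_add, map_smul' := hf_smul }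
  refine ⟨LinearMap.toMatrix' fₗ, LinearMap.ext fun p => ?_, fun G hG => h.resEnd_injective n ?_⟩
  · obtain ⟨x, rfl⟩ : ∃ x, reIm Ψ n x = p := ⟨(reIm Ψ n).symm p, (reIm Ψ n).apply_symm_apply p⟩
    rw [h.resEnd_reIm, ← Matrix.toLin'_apply, Matrix.toLin'_toMatrix', ← hf_reIm]
    rfl
  · rw [hG]
    refine LinearMap.ext fun p => ?_
    obtain ⟨x, rfl⟩ : ∃ x, reIm Ψ n x = p := ⟨(reIm Ψ n).symm p, (reIm Ψ n).apply_symm_apply p⟩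
    rw [h.resEnd_reIm, ← Matrix.toLin'_apply, Matrix.toLin'_toMatrix', ← hf_reIm]
    rfl

/-- **centraliser lemma (automorphisms)**: an `R`-linear automorphism `T` of `Rᴺ × Rᴺ` commuting with multiplication
by `δ` is `resAut G` for a unique `G ∈ GL_N(S)`. [cite: Lang2002, Ch. XIII §1] -/
theorem existsUnique_resAut_eq_of_forall_apply (T : ((n → R) × (n → R)) ≃ₗ[R] ((n → R) × (n → R)))
    (hT : ∀ p, T (h.resEnd n (Matrix.scalar n δ) p) = h.resEnd n (Matrix.scalar n δ) (T p)) :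
    ∃! G : GL n S, h.resAut n G = T := by
  have hT' : (T : Module.End R ((n → R) × (n → R))) ∘ₗ h.resEnd n (Matrix.scalar n δ) =
      h.resEnd n (Matrix.scalar n δ) ∘ₗ (T : Module.End R ((n → R) × (n → R))) :=
    LinearMap.ext fun p => hT p
  have hTs : (T.symm : Module.End R ((n → R) × (n → R))) ∘ₗ h.resEnd n (Matrix.scalar n δ) =
      h.resEnd n (Matrix.scalar n δ) ∘ₗ (T.symm : Module.End R ((n → R) × (n → R))) :=
    LinearMap.ext fun p => by
      apply T.injective
      simp only [LinearMap.coe_comp, LinearEquiv.coe_coe, Function.comp_apply, LinearEquiv.apply_symm_apply, hT]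
  obtain ⟨G, hG, -⟩ := h.existsUnique_resEnd_eq_of_comp_eq n _ hT'
  obtain ⟨G', hG', -⟩ := h.existsUnique_resEnd_eq_of_comp_eq n _ hTs
  have hGG' : G * G' = 1 := h.resEnd_injective n (by
    rw [map_mul, map_one, hG, hG']
    exact LinearMap.ext fun p => T.apply_symm_apply p)
  have hG'G : G' * G = 1 := h.resEnd_injective n (by
    rw [map_mul, map_one, hG, hG']
    exact LinearMap.ext fun p => T.symm_apply_apply p)
  refine ⟨⟨G, G', hGG', hG'G⟩, LinearEquiv.ext fun p => ?_, fun G₁ hG₁ => Units.ext (h.resEnd_injective n ?_)⟩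
  · rw [h.resAut_apply]
    exact LinearMap.congr_fun hG p
  · show h.resEnd n (G₁ : Matrix n n S) = h.resEnd n G
    rw [hG]
    exact LinearMap.ext fun p => by rw [← h.resAut_apply, hG₁]; rfl

end Literature.NumberTheory.Automorphic.UnitaryGroup.IsQuadraticCoordinates

namespace Literature.NumberTheory.GelbartRogawski1991

namespace Prop311

open QuadraticCoordinates

variable (F : Type) [Field F] [NumberField F]
variable (E : Type) [Field E] [NumberField E] [Algebra F E] [Algebra.IsQuadraticExtension F E]
variable (σ : E ≃ₐ[F] E) {δ : E} (hσδ : σ δ = -δ) (hδ : δ ≠ 0) {d : F} (hd : δ * δ = algebraMap F E d)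
variable (V : Type) [AddCommGroup V] [Module F V] [Module E V] [IsScalarTower F E V]
variable {n : ℕ} (b : Module.Basis (Fin n) E V)

/-! ## §1. The rational frame `V ≃ₗ[F] Fᴺ × Fᴺ` -/

section Rational

/-- **`Eᴺ ≃ₗ[F] Fᴺ × Fᴺ`**, `x ↦ (re ∘ x, im ∘ x)` for `E = F ⊕ F δ`: the quadratic coordinates `reIm` of the tree, as an
`F`-LINEAR isomorphism. [cite: GelbartRogawski1991, §3.1 p. 454 L41–42] -/
def ratReIm : (Fin n → E) ≃ₗ[F] (Fin n → F) × (Fin n → F) :=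
  (reIm (quadraticRatCoords E (not_mem_range_algebraMap_of_apply_eq_neg E σ hσδ hδ)).toAddEquiv (Fin n)).toLinearEquiv
    fun t x => by
      rw [← (isQuadraticCoordinates_rat E σ hσδ hδ hd).reIm_map_smul (Fin n) t x]
      congr 1
      funext i
      exact Algebra.smul_def t (x i)

/-- `ratReIm` IS `reIm` on elements. [cite: GelbartRogawski1991, §3.1 p. 454 L41–42] -/
@[simp] theorem ratReIm_apply (x : Fin n → E) :
    ratReIm F E σ hσδ hδ hd (n := n) x =
      reIm (quadraticRatCoords E (not_mem_range_algebraMap_of_apply_eq_neg E σ hσδ hδ)).toAddEquiv (Fin n) x :=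
  rfl

/-- **the rational frame `V ≃ₗ[F] Fᴺ × Fᴺ`** of an `E`-basis `b`: `v = Σᵢ (aᵢ + bᵢ δ) bᵢ ↦ (a, b)` ("`W` coincides with
`V`, but viewed as an `F`-vector space"). [cite: GelbartRogawski1991, §3.1 p. 454 L41–42] -/
def ratFrame : V ≃ₗ[F] (Fin n → F) × (Fin n → F) :=
  (b.equivFun.restrictScalars F).trans (ratReIm F E σ hσδ hδ hd)

/-- formula: `ratFrame b v = (re ∘ [v]_b, im ∘ [v]_b)`. [cite: GelbartRogawski1991, §3.1 p. 454 L41–42] -/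
theorem ratFrame_apply (v : V) :
    ratFrame F E σ hσδ hδ hd V b v =
      reIm (quadraticRatCoords E (not_mem_range_algebraMap_of_apply_eq_neg E σ hσδ hδ)).toAddEquiv (Fin n)
        (b.repr v) := by
  rw [ratFrame, LinearEquiv.trans_apply, LinearEquiv.restrictScalars_apply, Module.Basis.equivFun_apply]
  rfl

end Rational

/-! ## §2. The adelic frame `W_𝐀 = 𝐀 ⊗_F V ≃ₗ[𝐀] 𝐀ᴺ × 𝐀ᴺ` -/

section Adelic

/-- **the adelic frame `W_𝐀 = 𝐀 ⊗_F V ≃ₗ[𝐀] 𝐀ᴺ × 𝐀ᴺ`** of an `E`-basis `b` of `V`: `(ratFrame b) ⊗ 𝐀` followed by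
`𝐀 ⊗_F (Fᴺ × Fᴺ) = 𝐀ᴺ × 𝐀ᴺ`; its target is the carrier `𝔸ᴺ × 𝔸ᴺ` of the tree's `adelicToSymplectic`.
[cite: GelbartRogawski1991, §3.1 p. 454 L22, L41–42] -/
def adelicFrame :
    AdelicSpace F V ≃ₗ[AdeleRing (𝓞 F) F] (Fin n → AdeleRing (𝓞 F) F) × (Fin n → AdeleRing (𝓞 F) F) :=
  ((ratFrame F E σ hσδ hδ hd V b).baseChange F (AdeleRing (𝓞 F) F) V ((Fin n → F) × (Fin n → F))).trans
    ((TensorProduct.prodRight F (AdeleRing (𝓞 F) F) (AdeleRing (𝓞 F) F) (Fin n → F) (Fin n → F)).trans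
      ((TensorProduct.piScalarRight F (AdeleRing (𝓞 F) F) (AdeleRing (𝓞 F) F) (Fin n)).prodCongr
        (TensorProduct.piScalarRight F (AdeleRing (𝓞 F) F) (AdeleRing (𝓞 F) F) (Fin n))))

omit [Algebra.IsQuadraticExtension F E] [Module F V] [IsScalarTower F E V] in
/-- **the `E`-frame coordinates of a pure tensor**: `frameCoordE b t v = ((t ⊗ 1) · ([v]_bᵢ ⊗ 1))ᵢ ∈ 𝔸_Eᴺ`.
[cite: GelbartRogawski1991, §3.1 p. 454 L22, L41–42] -/
def frameCoordE (t : AdeleRing (𝓞 F) F) (v : V) : Fin n → AdeleRing (𝓞 E) E := fun i =>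
  AdeleRing.baseChange F E t * algebraMap E (AdeleRing (𝓞 E) E) (b.repr v i)

omit [Algebra.IsQuadraticExtension F E] [Module F V] [IsScalarTower F E V] in
/-- unfolding of `frameCoordE`. [cite: GelbartRogawski1991, §3.1 p. 454 L41–42] -/
@[simp] theorem frameCoordE_apply (t : AdeleRing (𝓞 F) F) (v : V) (i : Fin n) :
    frameCoordE F E V b t v i = AdeleRing.baseChange F E t * algebraMap E (AdeleRing (𝓞 E) E) (b.repr v i) := rfl

/-- **`adelicFrame b (t ⊗ v) = reIm Ψ_𝔸 (frameCoordE b t v)`**: on pure tensors the adelic frame is the tree's adelic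
quadratic coordinates `reIm` (`Ψ_𝔸 = quadraticAdeleEquiv`) of the `E`-frame coordinate vector.
[cite: GelbartRogawski1991, §3.1 p. 454 L22, L41–42] -/
theorem adelicFrame_tmul (t : AdeleRing (𝓞 F) F) (v : V) :
    adelicFrame F E σ hσδ hδ hd V b (t ⊗ₜ v) =
      reIm (quadraticAdeleEquiv F E σ hσδ hδ).toAddEquiv (Fin n) (frameCoordE F E V b t v) := by
  refine Prod.ext (funext fun i => ?_) (funext fun i => ?_) <;>
    simp only [adelicFrame, LinearEquiv.trans_apply, LinearEquiv.baseChange_tmul, ratFrame_apply,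
      TensorProduct.prodRight_tmul, LinearEquiv.prodCongr_apply, TensorProduct.piScalarRight_apply,
      TensorProduct.piScalarRightHom_tmul, reIm_apply_fst, reIm_apply_snd, frameCoordE_apply]
  · rw [(isQuadraticCoordinates_adele E σ hσδ hδ hd).re_map_mul, adele_re_algebraMap F E σ hσδ hδ hd,
      Algebra.smul_def, mul_comm]
  · rw [(isQuadraticCoordinates_adele E σ hσδ hδ hd).im_map_mul, adele_im_algebraMap F E σ hσδ hδ hd,
      Algebra.smul_def, mul_comm]

/-- two `𝐀`-linear maps out of `W_𝐀` with values anywhere agree as soon as they agree on pure tensors (restatement of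
`TensorProduct.AlgebraTensorModule.ext` for the printed `W_𝐀`). [cite: GelbartRogawski1991, §3.1 p. 454 L22] -/
theorem adelicSpace_linearMap_ext {M : Type*} [AddCommGroup M] [Module F M] [Module (AdeleRing (𝓞 F) F) M]
    [IsScalarTower F (AdeleRing (𝓞 F) F) M] {f g : AdelicSpace F V →ₗ[AdeleRing (𝓞 F) F] M} (hfg : ∀ (t : AdeleRing (𝓞 F) F) (v : V), f (t ⊗ₜ v) = g (t ⊗ₜ v)) :
    f = g :=
  TensorProduct.AlgebraTensorModule.ext hfg

end Adelic

/-! ## §3. Transport of the `E`-structure: scalars and rational (`1 ⊗ g₀`) maps -/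

section Transport

omit [Algebra.IsQuadraticExtension F E] [Module F V] [IsScalarTower F E V] in
/-- `frameCoordE b t (e • v) = (e ⊗ 1) · frameCoordE b t v`. [cite: GelbartRogawski1991, §3.1 p. 454 L37–38] -/
theorem frameCoordE_smul (e : E) (t : AdeleRing (𝓞 F) F) (v : V) :
    frameCoordE F E V b t (e • v) =
      Matrix.scalar (Fin n) (algebraMap E (AdeleRing (𝓞 E) E) e) *ᵥ frameCoordE F E V b t v := by
  funext i
  rw [Matrix.scalar_apply, Matrix.mulVec_diagonal, frameCoordE_apply, frameCoordE_apply, map_smul,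
    Finsupp.smul_apply, smul_eq_mul, map_mul]
  ring

/-- **transport of the scalars of `E`**: `adelicFrame b (scalarE e w) = resEnd (e · 1_N) (adelicFrame b w)` — print's
`1 ⊗ (e • ·)` on `W_𝐀` is multiplication by `e ⊗ 1 ∈ 𝔸_E` on `𝔸_Eᴺ`, read in the coordinates `reIm`.
[cite: GelbartRogawski1991, §3.1 p. 454 L37–38, L41–42] -/
theorem adelicFrame_scalarE (e : E) (w : AdelicSpace F V) :
    adelicFrame F E σ hσδ hδ hd V b (scalarE F E V e w) =
      (isQuadraticCoordinates_adele E σ hσδ hδ hd).resEnd (Fin n)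
        (Matrix.scalar (Fin n) (algebraMap E (AdeleRing (𝓞 E) E) e)) (adelicFrame F E σ hσδ hδ hd V b w) := by
  suffices hcomp : (adelicFrame F E σ hσδ hδ hd V b).toLinearMap ∘ₗ scalarE F E V e =
      (isQuadraticCoordinates_adele E σ hσδ hδ hd).resEnd (Fin n)
          (Matrix.scalar (Fin n) (algebraMap E (AdeleRing (𝓞 E) E) e)) ∘ₗ
        (adelicFrame F E σ hσδ hδ hd V b).toLinearMap from
    LinearMap.congr_fun hcomp w
  refine adelicSpace_linearMap_ext F V fun t v => ?_
  simp only [LinearMap.coe_comp, LinearEquiv.coe_coe, Function.comp_apply]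
  rw [scalarE, LinearMap.baseChange_tmul, LinearMap.restrictScalars_apply, LinearMap.lsmul_apply, adelicFrame_tmul,
    adelicFrame_tmul, frameCoordE_smul, (isQuadraticCoordinates_adele E σ hσδ hδ hd).resEnd_reIm]

omit [Algebra.IsQuadraticExtension F E] [Module F V] [IsScalarTower F E V] in
/-- `frameCoordE b t (g₀ v) = ([g₀]_b ⊗ 1) · frameCoordE b t v` for an `E`-linear `g₀`.
[cite: GelbartRogawski1991, Prop. 3.1.1 p. 455 L2] -/
theorem frameCoordE_apply_linearMap (g₀ : V →ₗ[E] V) (t : AdeleRing (𝓞 F) F) (v : V) :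
    frameCoordE F E V b t (g₀ v) =
      (LinearMap.toMatrix b b g₀).map (algebraMap E (AdeleRing (𝓞 E) E)) *ᵥ frameCoordE F E V b t v := by
  have hcoord : (frameCoordE F E V b t v : Fin n → AdeleRing (𝓞 E) E) =
      AdeleRing.baseChange F E t • ((algebraMap E (AdeleRing (𝓞 E) E)) ∘ (b.repr v : Fin n → E)) := by
    funext i
    rfl
  rw [hcoord, Matrix.mulVec_smul]
  funext i
  rw [Pi.smul_apply, smul_eq_mul, ← RingHom.map_mulVec, LinearMap.toMatrix_mulVec_repr, frameCoordE_apply]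

/-- **transport of rational maps**: `adelicFrame b ((1 ⊗ g₀) w) = resEnd ([g₀]_b ⊗ 1) (adelicFrame b w)` for an
`E`-linear `g₀ : V → V` — print's "`g = 1 ⊗ g₀`" (`IsRationalPoint`) is the tree's "matrix with entries in `E ⊗ 1`".
[cite: GelbartRogawski1991, Prop. 3.1.1 p. 455 L2] -/
theorem adelicFrame_baseChange (g₀ : V →ₗ[E] V) (w : AdelicSpace F V) :
    adelicFrame F E σ hσδ hδ hd V b ((g₀.restrictScalars F).baseChange (AdeleRing (𝓞 F) F) w) =
      (isQuadraticCoordinates_adele E σ hσδ hδ hd).resEnd (Fin n)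
        ((LinearMap.toMatrix b b g₀).map (algebraMap E (AdeleRing (𝓞 E) E))) (adelicFrame F E σ hσδ hδ hd V b w) := by
  suffices hcomp : (adelicFrame F E σ hσδ hδ hd V b).toLinearMap ∘ₗ (g₀.restrictScalars F).baseChange (AdeleRing (𝓞 F) F) =
      (isQuadraticCoordinates_adele E σ hσδ hδ hd).resEnd (Fin n)
          ((LinearMap.toMatrix b b g₀).map (algebraMap E (AdeleRing (𝓞 E) E))) ∘ₗ
        (adelicFrame F E σ hσδ hδ hd V b).toLinearMap from
    LinearMap.congr_fun hcomp w
  refine adelicSpace_linearMap_ext F V fun t v => ?_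
  simp only [LinearMap.coe_comp, LinearEquiv.coe_coe, Function.comp_apply]
  rw [LinearMap.baseChange_tmul, LinearMap.restrictScalars_apply, adelicFrame_tmul, adelicFrame_tmul,
    frameCoordE_apply_linearMap, (isQuadraticCoordinates_adele E σ hσδ hδ hd).resEnd_reIm]

/-- in particular for `δ`: `adelicFrame b ∘ scalarE δ = resEnd (δ · 1_N) ∘ adelicFrame b` with the tree's adelic `δ`.
[cite: GelbartRogawski1991, §3.1 p. 454 L37–38] -/
theorem adelicFrame_scalarE_delta (w : AdelicSpace F V) :
    adelicFrame F E σ hσδ hδ hd V b (scalarE F E V δ w) =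
      (isQuadraticCoordinates_adele E σ hσδ hδ hd).resEnd (Fin n)
        (Matrix.scalar (Fin n) (algebraMap E (AdeleRing (𝓞 E) E) δ)) (adelicFrame F E σ hσδ hδ hd V b w) :=
  adelicFrame_scalarE F E σ hσδ hδ hd V b δ w

end Transport

/-! ## §5. `GL_{𝐀 ⊗ E}(W_𝐀) ≃* GL_N(𝔸_E)` -/

section GLE

omit [NumberField E] [Algebra.IsQuadraticExtension F E] in
/-- **`GL_{𝐀 ⊗_F E}(W_𝐀)`**: the `𝐀`-linear automorphisms of `W_𝐀 = 𝐀 ⊗_F V` commuting with the scalars of `E` — the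
first clause of print's `G(𝐀)` (`Prop311.adelicUnitary`: "`𝐀 ⊗_F E`-linear automorphisms … preserving `Φ_𝐀`").
[cite: GelbartRogawski1991, §3.1 p. 454 L37–38; Prop. 3.1.1 p. 455 L1] -/
def adelicGLE : Subgroup (AdelicSpace F V ≃ₗ[AdeleRing (𝓞 F) F] AdelicSpace F V) where
  carrier := {g | ∀ (e : E) (x : AdelicSpace F V), g (scalarE F E V e x) = scalarE F E V e (g x)}
  mul_mem' := by
    intro g g' hg hg' e x
    rw [LinearEquiv.mul_apply, LinearEquiv.mul_apply, hg', hg]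
  one_mem' := fun _ _ => rfl
  inv_mem' := by
    intro g hg e x
    apply g.injective
    rw [LinearEquiv.coe_inv, LinearEquiv.apply_symm_apply, hg, LinearEquiv.apply_symm_apply]

omit [NumberField E] [Algebra.IsQuadraticExtension F E] in
/-- membership in `GL_{𝐀 ⊗ E}(W_𝐀)`. [cite: GelbartRogawski1991, §3.1 p. 454 L37–38] -/
theorem mem_adelicGLE (g : AdelicSpace F V ≃ₗ[AdeleRing (𝓞 F) F] AdelicSpace F V) :
    g ∈ adelicGLE F E V ↔ ∀ (e : E) (x : AdelicSpace F V), g (scalarE F E V e x) = scalarE F E V e (g x) :=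
  Iff.rfl

omit [NumberField E] [Algebra.IsQuadraticExtension F E] in
/-- `G(𝐀) ≤ GL_{𝐀 ⊗ E}(W_𝐀)`. [cite: GelbartRogawski1991, §3.1 p. 454 L37–38; Prop. 3.1.1 p. 455 L1] -/
theorem adelicUnitary_le_adelicGLE (Φ : V →ₗ[F] V →ₗ[F] E) : adelicUnitary F E V Φ ≤ adelicGLE F E V :=
  fun _ hg => hg.1

/-- the frame conjugate `adelicFrame b ∘ g ∘ (adelicFrame b)⁻¹` of an automorphism of `W_𝐀`, as an automorphism of
`𝐀ᴺ × 𝐀ᴺ`. [cite: GelbartRogawski1991, §3.1 p. 454 L41–42] -/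
def frameConj (g : AdelicSpace F V ≃ₗ[AdeleRing (𝓞 F) F] AdelicSpace F V) :
    ((Fin n → AdeleRing (𝓞 F) F) × (Fin n → AdeleRing (𝓞 F) F)) ≃ₗ[AdeleRing (𝓞 F) F]
      ((Fin n → AdeleRing (𝓞 F) F) × (Fin n → AdeleRing (𝓞 F) F)) :=
  (adelicFrame F E σ hσδ hδ hd V b).symm.trans (g.trans (adelicFrame F E σ hσδ hδ hd V b))

/-- formula: `frameConj b g (adelicFrame b w) = adelicFrame b (g w)`. [cite: GelbartRogawski1991, §3.1 p. 454 L41–42] -/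
@[simp] theorem frameConj_apply_adelicFrame (g : AdelicSpace F V ≃ₗ[AdeleRing (𝓞 F) F] AdelicSpace F V)
    (w : AdelicSpace F V) :
    frameConj F E σ hσδ hδ hd V b g (adelicFrame F E σ hσδ hδ hd V b w) = adelicFrame F E σ hσδ hδ hd V b (g w) := by
  rw [frameConj, LinearEquiv.trans_apply, LinearEquiv.trans_apply, LinearEquiv.symm_apply_apply]

/-- an element of `GL_{𝐀 ⊗ E}(W_𝐀)` commutes, in the frame, with multiplication by `δ`.
[cite: GelbartRogawski1991, §3.1 p. 454 L37–38] -/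
theorem frameConj_resEnd_scalar_delta {g : AdelicSpace F V ≃ₗ[AdeleRing (𝓞 F) F] AdelicSpace F V}
    (hg : g ∈ adelicGLE F E V) (p : (Fin n → AdeleRing (𝓞 F) F) × (Fin n → AdeleRing (𝓞 F) F)) :
    frameConj F E σ hσδ hδ hd V b g
        ((isQuadraticCoordinates_adele E σ hσδ hδ hd).resEnd (Fin n)
          (Matrix.scalar (Fin n) (algebraMap E (AdeleRing (𝓞 E) E) δ)) p) =
      (isQuadraticCoordinates_adele E σ hσδ hδ hd).resEnd (Fin n)
          (Matrix.scalar (Fin n) (algebraMap E (AdeleRing (𝓞 E) E) δ)) (frameConj F E σ hσδ hδ hd V b g p) := by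
  obtain ⟨w, rfl⟩ : ∃ w, adelicFrame F E σ hσδ hδ hd V b w = p :=
    ⟨(adelicFrame F E σ hσδ hδ hd V b).symm p, (adelicFrame F E σ hσδ hδ hd V b).apply_symm_apply p⟩
  rw [← adelicFrame_scalarE_delta, frameConj_apply_adelicFrame, frameConj_apply_adelicFrame, hg,
    adelicFrame_scalarE_delta]

/-- **the matrix of an element of `GL_{𝐀 ⊗ E}(W_𝐀)` in the frame `b`**: the unique `G ∈ GL_N(𝔸_E)` with
`adelicFrame b ∘ g = resAut G ∘ adelicFrame b` (centraliser lemma). [cite: GelbartRogawski1991, §3.1 p. 454 L37–42] -/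
def frameMatrix (g : adelicGLE F E V) : GL (Fin n) (AdeleRing (𝓞 E) E) :=
  Classical.choose ((isQuadraticCoordinates_adele E σ hσδ hδ hd).existsUnique_resAut_eq_of_forall_apply (Fin n)
    (frameConj F E σ hσδ hδ hd V b g) (frameConj_resEnd_scalar_delta F E σ hσδ hδ hd V b g.2)).exists

/-- the defining property of `frameMatrix`: `resAut (frameMatrix b g) = adelicFrame b ∘ g ∘ (adelicFrame b)⁻¹`.
[cite: GelbartRogawski1991, §3.1 p. 454 L37–42] -/
theorem resAut_frameMatrix (g : adelicGLE F E V) :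
    (isQuadraticCoordinates_adele E σ hσδ hδ hd).resAut (Fin n) (frameMatrix F E σ hσδ hδ hd V b g) =
      frameConj F E σ hσδ hδ hd V b g :=
  Classical.choose_spec ((isQuadraticCoordinates_adele E σ hσδ hδ hd).existsUnique_resAut_eq_of_forall_apply (Fin n)
    (frameConj F E σ hσδ hδ hd V b g) (frameConj_resEnd_scalar_delta F E σ hσδ hδ hd V b g.2)).exists

/-- uniqueness: any `G` with `resAut G = adelicFrame b ∘ g ∘ (adelicFrame b)⁻¹` is `frameMatrix b g`.
[cite: GelbartRogawski1991, §3.1 p. 454 L37–42] -/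
theorem frameMatrix_unique (g : adelicGLE F E V) {G : GL (Fin n) (AdeleRing (𝓞 E) E)}
    (hG : (isQuadraticCoordinates_adele E σ hσδ hδ hd).resAut (Fin n) G = frameConj F E σ hσδ hδ hd V b g) :
    G = frameMatrix F E σ hσδ hδ hd V b g :=
  ((isQuadraticCoordinates_adele E σ hσδ hδ hd).existsUnique_resAut_eq_of_forall_apply (Fin n)
    (frameConj F E σ hσδ hδ hd V b g) (frameConj_resEnd_scalar_delta F E σ hσδ hδ hd V b g.2)).unique hG
    (resAut_frameMatrix F E σ hσδ hδ hd V b g)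

/-- `frameConj` is multiplicative. [cite: GelbartRogawski1991, §3.1 p. 454 L41–42] -/
theorem frameConj_mul (g g' : AdelicSpace F V ≃ₗ[AdeleRing (𝓞 F) F] AdelicSpace F V) :
    frameConj F E σ hσδ hδ hd V b (g * g') = frameConj F E σ hσδ hδ hd V b g * frameConj F E σ hσδ hδ hd V b g' := by
  refine LinearEquiv.ext fun p => ?_
  obtain ⟨w, rfl⟩ : ∃ w, adelicFrame F E σ hσδ hδ hd V b w = p :=
    ⟨(adelicFrame F E σ hσδ hδ hd V b).symm p, (adelicFrame F E σ hσδ hδ hd V b).apply_symm_apply p⟩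
  rw [LinearEquiv.mul_apply, frameConj_apply_adelicFrame, frameConj_apply_adelicFrame, frameConj_apply_adelicFrame,
    LinearEquiv.mul_apply]

/-- **`frameGL b : GL_{𝐀 ⊗ E}(W_𝐀) ≃* GL_N(𝔸_E)`**, `g ↦ [g]_b`: in an `E`-frame the `𝐀 ⊗_F E`-linear automorphisms of
`W_𝐀` ARE the invertible `N × N` matrices over `𝔸_E` (acting on `𝐀ᴺ × 𝐀ᴺ` through the tree's `resAut`).
[cite: GelbartRogawski1991, §3.1 p. 454 L37–42] -/
def frameGL : adelicGLE F E V ≃* GL (Fin n) (AdeleRing (𝓞 E) E) where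
  toFun := frameMatrix F E σ hσδ hδ hd V b
  invFun G := ⟨(adelicFrame F E σ hσδ hδ hd V b).trans
      (((isQuadraticCoordinates_adele E σ hσδ hδ hd).resAut (Fin n) G).trans (adelicFrame F E σ hσδ hδ hd V b).symm),
    fun e x => by
      apply (adelicFrame F E σ hσδ hδ hd V b).injective
      have hc : (isQuadraticCoordinates_adele E σ hσδ hδ hd).resEnd (Fin n) (G : Matrix (Fin n) (Fin n) _) *
            (isQuadraticCoordinates_adele E σ hσδ hδ hd).resEnd (Fin n)
              (Matrix.scalar (Fin n) (algebraMap E (AdeleRing (𝓞 E) E) e)) =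
          (isQuadraticCoordinates_adele E σ hσδ hδ hd).resEnd (Fin n)
              (Matrix.scalar (Fin n) (algebraMap E (AdeleRing (𝓞 E) E) e)) *
            (isQuadraticCoordinates_adele E σ hσδ hδ hd).resEnd (Fin n) (G : Matrix (Fin n) (Fin n) _) := by
        rw [← map_mul, ← map_mul, ← (Matrix.scalar_commute (algebraMap E (AdeleRing (𝓞 E) E) e)
          (fun r' => Commute.all _ r') (G : Matrix (Fin n) (Fin n) (AdeleRing (𝓞 E) E))).eq]
      simp only [LinearEquiv.trans_apply, LinearEquiv.apply_symm_apply, adelicFrame_scalarE,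
        IsQuadraticCoordinates.resAut_apply]
      exact LinearMap.congr_fun hc (adelicFrame F E σ hσδ hδ hd V b x)⟩
  left_inv g := by
    refine Subtype.ext (LinearEquiv.ext fun w => ?_)
    apply (adelicFrame F E σ hσδ hδ hd V b).injective
    simp only [LinearEquiv.trans_apply, LinearEquiv.apply_symm_apply, resAut_frameMatrix, frameConj_apply_adelicFrame]
  right_inv G := by
    symm
    refine frameMatrix_unique F E σ hσδ hδ hd V b _ (LinearEquiv.ext fun p => ?_)
    obtain ⟨w, rfl⟩ : ∃ w, adelicFrame F E σ hσδ hδ hd V b w = p :=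
      ⟨(adelicFrame F E σ hσδ hδ hd V b).symm p, (adelicFrame F E σ hσδ hδ hd V b).apply_symm_apply p⟩
    rw [frameConj_apply_adelicFrame]
    simp only [LinearEquiv.trans_apply, LinearEquiv.apply_symm_apply]
  map_mul' g g' := by
    symm
    refine frameMatrix_unique F E σ hσδ hδ hd V b _ ?_
    rw [map_mul, resAut_frameMatrix, resAut_frameMatrix, Subgroup.coe_mul, frameConj_mul]

/-- **`adelicFrame b (g w) = resAut (frameGL b g) (adelicFrame b w)`**: the frame intertwines `g ∈ GL_{𝐀 ⊗ E}(W_𝐀)` with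
its matrix. [cite: GelbartRogawski1991, §3.1 p. 454 L37–42] -/
theorem adelicFrame_apply_eq_resAut_frameGL (g : adelicGLE F E V) (w : AdelicSpace F V) :
    adelicFrame F E σ hσδ hδ hd V b ((g : AdelicSpace F V ≃ₗ[AdeleRing (𝓞 F) F] AdelicSpace F V) w) =
      (isQuadraticCoordinates_adele E σ hσδ hδ hd).resAut (Fin n) (frameGL F E σ hσδ hδ hd V b g)
        (adelicFrame F E σ hσδ hδ hd V b w) := by
  rw [← frameConj_apply_adelicFrame, ← resAut_frameMatrix]
  rfl

/-- … and in terms of the tree's `reIm`: `adelicFrame b (g (adelicFrame b)⁻¹ (reIm x)) = reIm ((frameGL b g) x)` on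
`x ∈ 𝔸_Eᴺ`. [cite: GelbartRogawski1991, §3.1 p. 454 L37–42] -/
theorem adelicFrame_apply_symm_reIm (g : adelicGLE F E V) (x : Fin n → AdeleRing (𝓞 E) E) :
    adelicFrame F E σ hσδ hδ hd V b ((g : AdelicSpace F V ≃ₗ[AdeleRing (𝓞 F) F] AdelicSpace F V)
        ((adelicFrame F E σ hσδ hδ hd V b).symm (reIm (quadraticAdeleEquiv F E σ hσδ hδ).toAddEquiv (Fin n) x))) =
      reIm (quadraticAdeleEquiv F E σ hσδ hδ).toAddEquiv (Fin n)
        (((frameGL F E σ hσδ hδ hd V b g : GL (Fin n) (AdeleRing (𝓞 E) E)) :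
            Matrix (Fin n) (Fin n) (AdeleRing (𝓞 E) E)) *ᵥ x) := by
  rw [adelicFrame_apply_eq_resAut_frameGL, LinearEquiv.apply_symm_apply,
    (isQuadraticCoordinates_adele E σ hσδ hδ hd).resAut_reIm]

/-- the inverse: `(frameGL b)⁻¹ G = (adelicFrame b)⁻¹ ∘ resAut G ∘ adelicFrame b`.
[cite: GelbartRogawski1991, §3.1 p. 454 L37–42] -/
theorem coe_frameGL_symm_apply (G : GL (Fin n) (AdeleRing (𝓞 E) E)) (w : AdelicSpace F V) :
    (((frameGL F E σ hσδ hδ hd V b).symm G : adelicGLE F E V) :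
        AdelicSpace F V ≃ₗ[AdeleRing (𝓞 F) F] AdelicSpace F V) w =
      (adelicFrame F E σ hσδ hδ hd V b).symm
        ((isQuadraticCoordinates_adele E σ hσδ hδ hd).resAut (Fin n) G (adelicFrame F E σ hσδ hδ hd V b w)) :=
  rfl

omit [NumberField E] [Algebra.IsQuadraticExtension F E] in
/-- **rational points**: for an `E`-linear automorphism `g₀` of `V`, `1 ⊗ g₀ ∈ GL_{𝐀 ⊗ E}(W_𝐀)` (its matrix is
`[g₀]_b ⊗ 1`, entries in `E ⊗ 1 ⊂ 𝔸_E`: `coe_frameGL_baseChange`). [cite: GelbartRogawski1991, Prop. 3.1.1 p. 455 L2] -/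
theorem baseChange_mem_adelicGLE (g₀ : V ≃ₗ[E] V) :
    (g₀.restrictScalars F).baseChange F (AdeleRing (𝓞 F) F) V V ∈ adelicGLE F E V := fun e x => by
  induction x using TensorProduct.induction_on with
  | zero => simp only [map_zero]
  | tmul t v =>
    rw [scalarE, LinearMap.baseChange_tmul, LinearEquiv.baseChange_tmul, LinearEquiv.baseChange_tmul,
      LinearMap.baseChange_tmul]
    simp only [LinearMap.restrictScalars_apply, LinearMap.lsmul_apply, LinearEquiv.restrictScalars_apply, map_smul]
  | add x y hx hy => simp only [map_add, hx, hy]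

/-- the matrix of `1 ⊗ g₀` is `[g₀]_b ⊗ 1`. [cite: GelbartRogawski1991, Prop. 3.1.1 p. 455 L2] -/
theorem coe_frameGL_baseChange (g₀ : V ≃ₗ[E] V) :
    ((frameGL F E σ hσδ hδ hd V b ⟨(g₀.restrictScalars F).baseChange F (AdeleRing (𝓞 F) F) V V,
          baseChange_mem_adelicGLE F E V g₀⟩ : GL (Fin n) (AdeleRing (𝓞 E) E)) :
        Matrix (Fin n) (Fin n) (AdeleRing (𝓞 E) E)) =
      (LinearMap.toMatrix b b (g₀ : V →ₗ[E] V)).map (algebraMap E (AdeleRing (𝓞 E) E)) := by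
  apply (isQuadraticCoordinates_adele E σ hσδ hδ hd).resEnd_injective (Fin n)
  refine LinearMap.ext fun p => ?_
  obtain ⟨w, rfl⟩ : ∃ w, adelicFrame F E σ hσδ hδ hd V b w = p :=
    ⟨(adelicFrame F E σ hσδ hδ hd V b).symm p, (adelicFrame F E σ hσδ hδ hd V b).apply_symm_apply p⟩
  rw [← (isQuadraticCoordinates_adele E σ hσδ hδ hd).resAut_apply, ← adelicFrame_apply_eq_resAut_frameGL,
    ← adelicFrame_baseChange]
  rfl

end GLE

/-! ## §6. Continuity: the frame is a homeomorphism for the adelic topology of `W_𝐀` -/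

section Continuity

/-- **the adelic frame is continuous** for the adelic (module) topology of `W_𝐀` (rendering R8 of `Prop311AsPrinted`)
and the product topology of `𝐀ᴺ × 𝐀ᴺ`. [cite: GelbartRogawski1991, Prop. 3.1.1 p. 455 L1–2] -/
theorem continuous_adelicFrame :
    @Continuous _ _ (adelicSpaceTopology F V) _ (adelicFrame F E σ hσδ hδ hd V b) := by
  letI : TopologicalSpace (AdelicSpace F V) := adelicSpaceTopology F V
  haveI : IsModuleTopology (AdeleRing (𝓞 F) F) (AdelicSpace F V) := ⟨rfl⟩
  exact IsModuleTopology.continuous_of_linearMap (adelicFrame F E σ hσδ hδ hd V b).toLinearMap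

/-- **the inverse frame is continuous**: any `𝐀`-linear map out of `𝐀ᴺ × 𝐀ᴺ` into `W_𝐀` is, for the module topology.
[cite: GelbartRogawski1991, Prop. 3.1.1 p. 455 L1–2] -/
theorem continuous_adelicFrame_symm :
    @Continuous _ _ _ (adelicSpaceTopology F V) (adelicFrame F E σ hσδ hδ hd V b).symm := by
  letI : TopologicalSpace (AdelicSpace F V) := adelicSpaceTopology F V
  haveI : IsModuleTopology (AdeleRing (𝓞 F) F) (AdelicSpace F V) := ⟨rfl⟩
  haveI : ContinuousAdd (AdelicSpace F V) := IsModuleTopology.toContinuousAdd (AdeleRing (𝓞 F) F) (AdelicSpace F V)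
  exact IsModuleTopology.continuous_of_linearMap (adelicFrame F E σ hσδ hδ hd V b).symm.toLinearMap

/-- **the adelic frame as a homeomorphism `W_𝐀 ≃ₜ 𝐀ᴺ × 𝐀ᴺ`** (adelic topology of `W_𝐀`).
[cite: GelbartRogawski1991, Prop. 3.1.1 p. 455 L1–2] -/
def adelicFrameHomeomorph :
    @Homeomorph (AdelicSpace F V) ((Fin n → AdeleRing (𝓞 F) F) × (Fin n → AdeleRing (𝓞 F) F))
      (adelicSpaceTopology F V) _ :=
  letI : TopologicalSpace (AdelicSpace F V) := adelicSpaceTopology F V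
  { (adelicFrame F E σ hσδ hδ hd V b).toEquiv with
    continuous_toFun := continuous_adelicFrame F E σ hσδ hδ hd V b
    continuous_invFun := continuous_adelicFrame_symm F E σ hσδ hδ hd V b }

/-- `adelicFrameHomeomorph` is `adelicFrame` on elements. [cite: GelbartRogawski1991, Prop. 3.1.1 p. 455 L1–2] -/
@[simp] theorem adelicFrameHomeomorph_apply (w : AdelicSpace F V) :
    adelicFrameHomeomorph F E σ hσδ hδ hd V b w = adelicFrame F E σ hσδ hδ hd V b w := rfl

end Continuity

end Prop311

end Literature.NumberTheory.GelbartRogawski1991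

end
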